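import Literature.LinearAlgebra.TensorNetworks.QuanticsTensorTrain

/-!
# Explicit low-rank QTT representations of the one-dimensional shift, gradient and
# finite-difference Laplace matrices (Kazeev–Khoromskij)

A `2^d × 2^d` matrix `A` is written in the QUANTIZED TENSOR TRAIN (QTT) MATRIX format — a
tensor-train operator / matrix product operator with `d` sites and `2 × 2` mode sizes — when,
with the binary codings `m = (i₁ i₂ ⋯ i_d)₂`, `n = (j₁ j₂ ⋯ j_d)₂` of the row and column indices
(most significant bit first),
`A(m, n) = U₁(i₁, j₁) U₂(i₂, j₂) ⋯ U_d(i_d, j_d)`,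
a product of an `1 × r₁` row, `r_{k-1} × r_k` matrices and an `r_{d-1} × 1` column depending on
the digit pairs [KazeevKhoromskij2012, eq. (2) and the paragraph "Further tensorization";
Khoromskij2015, Def. 1.3 (TT-operator, TTO/MPO)].  Kazeev and Khoromskij write such
decompositions as STRONG KRONECKER ("inner core", "rank") PRODUCTS `U₁ ⋈ U₂ ⋈ ⋯ ⋈ U_d` of CORE
MATRICES whose entries are the `2 × 2` blocks `(U_k)_{αβ} = (U_k(i, j)_{αβ})_{i,j}`
[KazeevKhoromskij2012, Def. 0.4 and Rem. 0.6; VysotskyRakhuba2022, Def. 4.1], built from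
`I = [1 0; 0 1]`, `J = [0 1; 0 0]`, `J' = Jᵀ`, `I₁ = [1 0; 0 0]`, `I₂ = [0 0; 0 1]`
[KazeevKhoromskij2012, eq. (7)], and prove [KazeevKhoromskij2012, eqs. (12)–(14), Lem. 2.1,
Lem. 2.2 and its proof; the rank-3 Laplacian is displayed again in Khoromskij2015, §1.4]:

* the SHIFT matrix `S^{(d)}` (ones on the superdiagonal) and the GRADIENT matrix
  `G^{(d)} = I - S^{(d)}` have QTT ranks `2`:
  `S^{(d)} = [I J] ⋈ [I J; 0 J']^{⋈(d-2)} ⋈ [J; J']`,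
  `G^{(d)} = [I J] ⋈ [I J; 0 J']^{⋈(d-2)} ⋈ [I-J; -J']`;
* the periodic shift `S_P^{(d)} = S^{(d)} + J'^{⊗d}` has QTT ranks `3`:
  `S_P^{(d)} = [I J J'] ⋈ diag(I J; 0 J' | J')^{⋈(d-2)} ⋈ [J; J'; J']`;
* (LEMMA 2.1) the Dirichlet LAPLACIAN `Δ_DD^{(d)} = tridiag(-1, 2, -1)` has QTT ranks `3`:
  `Δ_DD^{(d)} = [I J' J] ⋈ [I J' J; 0 J 0; 0 0 J']^{⋈(d-2)} ⋈ [2I-J-J'; -J; -J']`;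
* (LEMMA 2.2) the Dirichlet–Neumann and Neumann–Dirichlet matrices
  `Δ_DN^{(d)} = Δ_DD^{(d)} - I₂^{⊗d}`, `Δ_ND^{(d)} = Δ_DD^{(d)} - I₁^{⊗d}` (the last, resp. first,
  diagonal entry lowered to `1`) have QTT ranks `4` (a fourth diagonal channel `I₂`, resp. `I₁`),
  and the periodic Laplacian `Δ_P^{(d)} = Δ_DD^{(d)} - J^{⊗d} - J'^{⊗d}` has the rank-`5`
  representation `[I J' J J J'] ⋈ diag(I J' J; 0 J 0; 0 0 J' | J | J')^{⋈(d-2)} ⋈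
  [2I-J-J'; -J; -J'; -J; -J']` (the first display in the proof of Lem. 2.2).

The paper states Lem. 2.1 for `d ≥ 2` and Lem. 2.2 for `d ≥ 4` (three-factor strong Kronecker
products); the boundary-vector form used below holds for every `d ≥ 0`.

This file formalises these representations EXACTLY, in the tensor-train language of
`Literature.LinearAlgebra.TensorNetworks.QuanticsTensorTrain` (a core matrix with `2 × 2` blocks
IS the train core `(i, j) ↦ (U(i, j)_{αβ})_{αβ}` on the leg `Fin 2 × Fin 2`; the boundary cores
are absorbed into boundary vectors, `[I J' J] = e₀ᵀ ⋈ W`, `[2I-J-J'; -J; -J'] = W ⋈ (2,-1,-1)ᵀ`,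
which makes every statement uniform in `d ≥ 0`):

* `TensorTrain.qttMatrix` — the `b^R × b^R` matrix represented by a train on the legs
  `Fin b × Fin b` (digit pairs, most significant first: `quanticsEquiv`), `qttMatrix_apply`,
  `qttMatrix_eq_iff` [KazeevKhoromskij2012, eq. (2)];
* `TensorTrain.vecMul_chainProd_of_digitStep`, `eval_uniform_of_digitStep` — the DIGIT
  RECURSION behind all the proofs below: if a family of state vectors `F_k(m, n) ∈ K^r` indexed
  by pairs of `k`-digit numbers satisfies `F_{k+1}(bm + a, bn + a') = F_k(m, n) · W(a, a')`, then
  `F_d(m, n) = F_0(0, 0) · W(i₁, j₁) ⋯ W(i_d, j_d)` (this file's rendering of the recursive block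
  structure `Δ^{(k)} = I ⊗ Δ^{(k-1)} - J' ⊗ J^{⊗(k-1)} - J ⊗ J'^{⊗(k-1)}` used in the cited
  proofs) [KazeevKhoromskij2012, Lem. 2.1 (proof)];
* the blocks `blkI`, `blkJ`, `blkJ'`, `blkI₁`, `blkI₂` [KazeevKhoromskij2012, eq. (7)], the target
  matrices `shiftS`, `gradG`, `laplaceDD`, `laplaceDN`, `laplaceND`, `laplaceP` of any size `N`
  [KazeevKhoromskij2012, §1.2 and eqs. (4)–(6)], the cores `shiftCore`, `shiftPCore`, `lapCore`,
  `lapDNCore`, `lapNDCore`, `lapPCore` and the trains `shiftTrain c`, `shiftPTrain`, `lapTrain`,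
  `lapDNTrain`, `lapNDTrain`, `lapPTrain`;
* `qttMatrix_shiftTrain` (`c = (0, 1)`: `S^{(d)}`, eq. (13); `c = (1, -1)`: `G^{(d)}`, eq. (12):
  `qttMatrix_shiftTrain_shift`, `qttMatrix_shiftTrain_grad`), `qttMatrix_shiftPTrain` (eq. (14)),
  `qttMatrix_lapTrain` (Lem. 2.1), `qttMatrix_lapDNTrain`, `qttMatrix_lapNDTrain` (Lem. 2.2),
  `qttMatrix_lapPTrain` (proof of Lem. 2.2), each with its state-vector lemma
  `vecMul_chainProd_*Core`;
* `laplaceDD_eq_lapFirst_mul_chainProd_mul_lapLast` — Lemma 2.1 VERBATIM for `d ≥ 2`: the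
  `(i, j)`-entry of `[I J' J] ⋈ W^{⋈(d-2)} ⋈ [2I-J-J'; -J; -J']`, i.e. the `1 × 1` matrix
  `lapFirst(i₁,j₁) · W(i₂,j₂) ⋯ W(i_{d-1},j_{d-1}) · lapLast(i_d,j_d)`, is `Δ_DD^{(d)}(m, n)`.

Not formalised: the rank-`4` Neumann matrix `Δ_NN^{(d)}` and the boundary-rank reductions of
Lem. 2.2 (`Δ_P^{(d)}` with ranks `2, 3, …, 3`), minimality of the ranks, the multidimensional
Laplace-like sums of Lem. 1.1 / eq. (3), the explicit QTT structure of the INVERSE `(Δ_DD^{(d)})⁻¹`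
(§3, Thm. 4.1 of the cited paper) and of circulant inverses [VysotskyRakhuba2022], and anything
approximate.  Numbering `Def. 0.4`, `eqs. (2), (4)–(7), (12)–(14)`, `Lem. 1.1, 2.1, 2.2`,
`Rem. 0.6` follows the Max Planck Institute MIS Leipzig Preprint 75/2010 version of
[KazeevKhoromskij2012].

References: V. A. Kazeev, B. N. Khoromskij, *Low-rank explicit QTT representation of the Laplace
operator and its inverse*, SIAM J. Matrix Anal. Appl. 33 (2012) 742–758, MPI MIS Preprint
75/2010 (`KazeevKhoromskij2012`); B. N. Khoromskij, *Tensor numerical methods for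
multidimensional PDEs: theoretical analysis and initial applications*, ESAIM Proc. Surveys 48
(2015) 1–28 (`Khoromskij2015`), Def. 1.3, §1.4; L. Vysotsky, M. Rakhuba, *Tensor rank bounds and
explicit QTT representations for the inverses of circulant matrices*, Numer. Linear Algebra
Appl. 30 (2023) e2461, arXiv:2205.04335 (`VysotskyRakhuba2022`), Def. 4.1.

AI-produced formalisation (H21 engines group, seat eng-quad-2, 2026-08-23); no facts, no axioms
beyond Mathlib's, no `sorry`.
-/

open Matrix Finset

namespace Literature.LinearAlgebra.TensorNetworks

universe u

/-! ### QTT matrices and the digit recursion -/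

namespace TensorTrain

variable {K : Type u} [CommSemiring K] {b R : ℕ}

/-- THE QTT MATRIX (tensor-train operator, matrix product operator) represented by a train `T`
on the legs `Fin b × Fin b`: `A(m, n) = T((i₁, j₁), …, (i_R, j_R))` where `i`, `j` are the
base-`b` digits of `m`, `n`, most significant first [KazeevKhoromskij2012, eq. (2) with the
binary coding `i = 1 + Σ_k 2^{d-k} (i_k - 1)`; Khoromskij2015, Def. 1.3].
[cite: KazeevKhoromskij2012, eq. (2)] -/
def qttMatrix (T : TensorTrain K (Fin b × Fin b) R) : Matrix (Fin (b ^ R)) (Fin (b ^ R)) K :=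
  Matrix.of fun m n => T.eval fun r => ((quanticsEquiv b R).symm m r, (quanticsEquiv b R).symm n r)

/-- The entry of the QTT matrix at a pair of digit strings is the value of the train at the
string of digit pairs.  [cite: KazeevKhoromskij2012, eq. (2)] -/
theorem qttMatrix_apply (T : TensorTrain K (Fin b × Fin b) R) (σ μ : Fin R → Fin b) :
    T.qttMatrix (quanticsEquiv b R σ) (quanticsEquiv b R μ) = T.eval fun r => (σ r, μ r) := by
  simp [qttMatrix]

/-- A train represents the matrix `A` iff its values at digit-pair strings are the entries of `A`
at the encoded indices.  [cite: KazeevKhoromskij2012, eq. (2)] -/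
theorem qttMatrix_eq_iff (T : TensorTrain K (Fin b × Fin b) R)
    (A : Matrix (Fin (b ^ R)) (Fin (b ^ R)) K) :
    T.qttMatrix = A ↔ ∀ σ μ : Fin R → Fin b,
      T.eval (fun r => (σ r, μ r)) = A (quanticsEquiv b R σ) (quanticsEquiv b R μ) := by
  constructor
  · rintro rfl σ μ
    exact (qttMatrix_apply T σ μ).symm
  · intro h
    ext m n
    obtain ⟨σ, rfl⟩ := (quanticsEquiv b R).surjective m
    obtain ⟨μ, rfl⟩ := (quanticsEquiv b R).surjective n
    rw [qttMatrix_apply, h]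

/-- THE DIGIT RECURSION (transfer-matrix / automaton form of the recursive block structure
`A^{(k+1)} = Σ_{αβ} (block)_{αβ} ⊗ …` in the cited proofs): if state vectors `F k m n ∈ K^r`
attached to pairs of `k`-digit numbers obey `F (k+1) (b m + a) (b n + a') = F k m n · W(a, a')`
for all digits `a, a'`, then reading the digit pairs of `m(σ)`, `m(μ)` most significant first,
`F 0 0 0 · W(σ₀, μ₀) ⋯ W(σ_{R-1}, μ_{R-1}) = F R m(σ) m(μ)`.
[cite: KazeevKhoromskij2012, Lem. 2.1] -/
theorem vecMul_chainProd_of_digitStep {n : ℕ} (W : Fin b × Fin b → Matrix (Fin n) (Fin n) K)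
    (F : ℕ → ℕ → ℕ → Fin n → K)
    (hF : ∀ (k m m' : ℕ) (a a' : Fin b), m < b ^ k → m' < b ^ k →
      F (k + 1) (b * m + a) (b * m' + a') = F k m m' ᵥ* W (a, a')) :
    ∀ (R : ℕ) (σ μ : Fin R → Fin b),
      F 0 0 0 ᵥ* chainProd (fun _ => W) R (fun r => (σ r, μ r)) =
        F R (quanticsEquiv b R σ) (quanticsEquiv b R μ)
  | 0, σ, μ => by simp [chainProd]
  | R + 1, σ, μ => by
      have hσ : σ = Fin.snoc (α := fun _ => Fin b) (Fin.init σ) (σ (Fin.last R)) :=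
        (Fin.snoc_init_self σ).symm
      have hμ : μ = Fin.snoc (α := fun _ => Fin b) (Fin.init μ) (μ (Fin.last R)) :=
        (Fin.snoc_init_self μ).symm
      rw [chainProd, ← Matrix.vecMul_vecMul]
      have ih := vecMul_chainProd_of_digitStep W F hF R (Fin.init σ) (Fin.init μ)
      rw [show (fun r : Fin R => ((Fin.init σ : Fin R → Fin b) r, (Fin.init μ : Fin R → Fin b) r)) =
        Fin.init fun r : Fin (R + 1) => (σ r, μ r) from rfl] at ih
      rw [ih]
      conv_rhs => rw [hσ, hμ]
      rw [val_quanticsEquiv_snoc, val_quanticsEquiv_snoc]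
      exact (hF R _ _ _ _ (Fin.isLt _) (Fin.isLt _)).symm

/-- Hence the uniform train with cores `W`, left boundary `F 0 0 0` and right boundary `c`
represents, in the QTT matrix format, `(m, n) ↦ F R m n ⬝ c`.
[cite: KazeevKhoromskij2012, Lem. 2.1] -/
theorem eval_uniform_of_digitStep {n : ℕ} (W : Fin b × Fin b → Matrix (Fin n) (Fin n) K)
    (F : ℕ → ℕ → ℕ → Fin n → K)
    (hF : ∀ (k m m' : ℕ) (a a' : Fin b), m < b ^ k → m' < b ^ k →
      F (k + 1) (b * m + a) (b * m' + a') = F k m m' ᵥ* W (a, a'))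
    (c : Fin n → K) (R : ℕ) (σ μ : Fin R → Fin b) :
    (uniform R n (fun _ => W) (F 0 0 0) c).eval (fun r => (σ r, μ r)) =
      F R (quanticsEquiv b R σ) (quanticsEquiv b R μ) ⬝ᵥ c := by
  rw [eval_uniform, vecMul_chainProd_of_digitStep W F hF]

/-- Peeling off the FIRST core of a chain of identical cores (the chain is defined by peeling off
the last one): `W(s₀) ⋯ W(s_k) = W(s₀) · (W(s₁) ⋯ W(s_k))`.
[cite: KazeevKhoromskij2012, Rem. 0.6] -/
theorem chainProd_succ_eq_mul {σ : Type*} {n : ℕ} (W : σ → Matrix (Fin n) (Fin n) K) :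
    ∀ (k : ℕ) (s : Fin (k + 1) → σ),
      chainProd (fun _ => W) (k + 1) s = W (s 0) * chainProd (fun _ => W) k (Fin.tail s)
  | 0, s => by simp [chainProd]
  | k + 1, s => by
      rw [chainProd, chainProd_succ_eq_mul W k (Fin.init s), chainProd, Matrix.mul_assoc]
      rfl

end TensorTrain

/-! ### The Kazeev–Khoromskij blocks, cores and target matrices -/

section KazeevKhoromskij

variable (K : Type u) [CommRing K]

/-- The block `I = [1 0; 0 1]` as a function of the digit pair `(i, j)` (row digit, column
digit).  [cite: KazeevKhoromskij2012, eq. (7)] -/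
def blkI (p : Fin 2 × Fin 2) : K := if p.1 = p.2 then 1 else 0

/-- The block `J = [0 1; 0 0]` (`J(i, j) = 1` iff `(i, j) = (0, 1)`: the `2 × 2` shift).
[cite: KazeevKhoromskij2012, eq. (7)] -/
def blkJ (p : Fin 2 × Fin 2) : K := if p.1 = 0 ∧ p.2 = 1 then 1 else 0

/-- The block `J' = Jᵀ = [0 0; 1 0]` (`J'(i, j) = 1` iff `(i, j) = (1, 0)`).
[cite: KazeevKhoromskij2012, eq. (7)] -/
def blkJ' (p : Fin 2 × Fin 2) : K := if p.1 = 1 ∧ p.2 = 0 then 1 else 0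

/-- The block `I₁ = [1 0; 0 0]`.  [cite: KazeevKhoromskij2012, eq. (7)] -/
def blkI₁ (p : Fin 2 × Fin 2) : K := if p.1 = 0 ∧ p.2 = 0 then 1 else 0

/-- The block `I₂ = [0 0; 0 1]`.  [cite: KazeevKhoromskij2012, eq. (7)] -/
def blkI₂ (p : Fin 2 × Fin 2) : K := if p.1 = 1 ∧ p.2 = 1 then 1 else 0

/-- THE SHIFT MATRIX `S` of size `N`: ones on the superdiagonal, `S(m, n) = 𝟙[n = m + 1]`.
[cite: KazeevKhoromskij2012, §1.2] -/
def shiftS (N : ℕ) : Matrix (Fin N) (Fin N) K :=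
  Matrix.of fun m n => if (n : ℕ) = m + 1 then 1 else 0

/-- THE GRADIENT MATRIX `G = I - S` of size `N`: `1` on the diagonal, `-1` on the superdiagonal.
[cite: KazeevKhoromskij2012, §1.2] -/
def gradG (N : ℕ) : Matrix (Fin N) (Fin N) K :=
  Matrix.of fun m n => if (m : ℕ) = n then 1 else if (n : ℕ) = m + 1 then -1 else 0

/-- THE DIRICHLET LAPLACIAN `Δ_DD = tridiag(-1, 2, -1)` of size `N`.
[cite: KazeevKhoromskij2012, eq. (4)] -/
def laplaceDD (N : ℕ) : Matrix (Fin N) (Fin N) K :=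
  Matrix.of fun m n =>
    if (m : ℕ) = n then 2 else if (n : ℕ) = m + 1 ∨ (m : ℕ) = n + 1 then -1 else 0

/-- THE DIRICHLET–NEUMANN MATRIX `Δ_DN`: `tridiag(-1, 2, -1)` with the LAST diagonal entry `1`.
[cite: KazeevKhoromskij2012, eq. (5)] -/
def laplaceDN (N : ℕ) : Matrix (Fin N) (Fin N) K :=
  Matrix.of fun m n =>
    if (m : ℕ) = n then (if (m : ℕ) + 1 = N then 1 else 2)
    else if (n : ℕ) = m + 1 ∨ (m : ℕ) = n + 1 then -1 else 0

/-- THE NEUMANN–DIRICHLET MATRIX `Δ_ND`: `tridiag(-1, 2, -1)` with the FIRST diagonal entry `1`.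
[cite: KazeevKhoromskij2012, eq. (5)] -/
def laplaceND (N : ℕ) : Matrix (Fin N) (Fin N) K :=
  Matrix.of fun m n =>
    if (m : ℕ) = n then (if (m : ℕ) = 0 then 1 else 2)
    else if (n : ℕ) = m + 1 ∨ (m : ℕ) = n + 1 then -1 else 0

/-- THE PERIODIC LAPLACIAN `Δ_P = 2I - S_P - S_Pᵀ` of size `N`, `S_P` the cyclic shift
(`S_P(m, n) = 𝟙[n ≡ m + 1 (mod N)]`): for `N ≥ 3` this is `tridiag(-1, 2, -1)` with corner
entries `-1` (eq. (6)); for `N = 2` it is `[2 -2; -2 2]` and for `N = 1` it is `0`, in accordance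
with `Δ_P^{(d)} = Δ_DD^{(d)} - J^{⊗d} - J'^{⊗d}` (proof of Lem. 2.2).
[cite: KazeevKhoromskij2012, eq. (6)] -/
def laplaceP (N : ℕ) : Matrix (Fin N) (Fin N) K :=
  Matrix.of fun m n =>
    (if (m : ℕ) = n then 2 else 0)
      - (if (n : ℕ) = m + 1 ∨ ((m : ℕ) + 1 = N ∧ (n : ℕ) = 0) then 1 else 0)
      - (if (m : ℕ) = n + 1 ∨ ((n : ℕ) + 1 = N ∧ (m : ℕ) = 0) then 1 else 0)

/-- The middle core `[I J; 0 J']` of the shift and gradient matrices (eqs. (12), (13)), as the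
train core `(i, j) ↦ [I(i,j) J(i,j); 0 J'(i,j)]`.  [cite: KazeevKhoromskij2012, eq. (13)] -/
def shiftCore (p : Fin 2 × Fin 2) : Matrix (Fin 2) (Fin 2) K :=
  !![blkI K p, blkJ K p; 0, blkJ' K p]

/-- The middle core `[I J 0; 0 J' 0; 0 0 J']` of the periodic shift (eq. (14)).
[cite: KazeevKhoromskij2012, eq. (14)] -/
def shiftPCore (p : Fin 2 × Fin 2) : Matrix (Fin 3) (Fin 3) K :=
  !![blkI K p, blkJ K p, 0; 0, blkJ' K p, 0; 0, 0, blkJ' K p]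

/-- The middle core `W = [I J' J; 0 J 0; 0 0 J']` of the Dirichlet Laplacian (Lem. 2.1), as the
train core `(i, j) ↦ (W_{αβ}(i, j))_{αβ}`.  [cite: KazeevKhoromskij2012, Lem. 2.1] -/
def lapCore (p : Fin 2 × Fin 2) : Matrix (Fin 3) (Fin 3) K :=
  !![blkI K p, blkJ' K p, blkJ K p; 0, blkJ K p, 0; 0, 0, blkJ' K p]

/-- The first core `[I J' J]` of Lem. 2.1 (a `1 × 3` core matrix).
[cite: KazeevKhoromskij2012, Lem. 2.1] -/
def lapFirst (p : Fin 2 × Fin 2) : Matrix (Fin 1) (Fin 3) K :=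
  !![blkI K p, blkJ' K p, blkJ K p]

/-- The last core `[2I - J - J'; -J; -J']` of Lem. 2.1 (a `3 × 1` core matrix).
[cite: KazeevKhoromskij2012, Lem. 2.1] -/
def lapLast (p : Fin 2 × Fin 2) : Matrix (Fin 3) (Fin 1) K :=
  !![2 * blkI K p - blkJ K p - blkJ' K p; -blkJ K p; -blkJ' K p]

/-- The middle core `[I J' J 0; 0 J 0 0; 0 0 J' 0; 0 0 0 I₂]` of `Δ_DN` (Lem. 2.2).
[cite: KazeevKhoromskij2012, Lem. 2.2] -/
def lapDNCore (p : Fin 2 × Fin 2) : Matrix (Fin 4) (Fin 4) K :=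
  !![blkI K p, blkJ' K p, blkJ K p, 0; 0, blkJ K p, 0, 0; 0, 0, blkJ' K p, 0; 0, 0, 0, blkI₂ K p]

/-- The middle core `[I J' J 0; 0 J 0 0; 0 0 J' 0; 0 0 0 I₁]` of `Δ_ND` (Lem. 2.2).
[cite: KazeevKhoromskij2012, Lem. 2.2] -/
def lapNDCore (p : Fin 2 × Fin 2) : Matrix (Fin 4) (Fin 4) K :=
  !![blkI K p, blkJ' K p, blkJ K p, 0; 0, blkJ K p, 0, 0; 0, 0, blkJ' K p, 0; 0, 0, 0, blkI₁ K p]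

/-- The middle core `diag([I J' J; 0 J 0; 0 0 J'], J, J')` of the rank-`5` representation of the
periodic Laplacian (proof of Lem. 2.2).  [cite: KazeevKhoromskij2012, Lem. 2.2] -/
def lapPCore (p : Fin 2 × Fin 2) : Matrix (Fin 5) (Fin 5) K :=
  !![blkI K p, blkJ' K p, blkJ K p, 0, 0; 0, blkJ K p, 0, 0, 0; 0, 0, blkJ' K p, 0, 0;
    0, 0, 0, blkJ K p, 0; 0, 0, 0, 0, blkJ' K p]

/-- The rank-`2` train `[I J] ⋈ [I J; 0 J']^{⋈(d-2)} ⋈ ([I J; 0 J'] ⋈ c)` with a general right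
boundary `c`: `c = (0, 1)` gives the shift (13), `c = (1, -1)` the gradient (12) (uniform form:
`[I J] = (1, 0) ⋈ [I J; 0 J']`).  [cite: KazeevKhoromskij2012, eq. (13)] -/
def shiftTrain (c : Fin 2 → K) (d : ℕ) : TensorTrain K (Fin 2 × Fin 2) d :=
  TensorTrain.uniform d 2 (fun _ => shiftCore K) ![1, 0] c

/-- The rank-`3` train of the periodic shift (14) in uniform form: cores
`[I J 0; 0 J' 0; 0 0 J']`, boundaries `(1, 0, 1)` and `(0, 1, 1)`.
[cite: KazeevKhoromskij2012, eq. (14)] -/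
def shiftPTrain (d : ℕ) : TensorTrain K (Fin 2 × Fin 2) d :=
  TensorTrain.uniform d 3 (fun _ => shiftPCore K) ![1, 0, 1] ![0, 1, 1]

/-- THE RANK-`3` TRAIN OF THE DIRICHLET LAPLACIAN (Lem. 2.1) in uniform form: cores
`W = [I J' J; 0 J 0; 0 0 J']`, boundaries `e₀ = (1, 0, 0)` and `(2, -1, -1)`
(`[I J' J] = e₀ᵀ ⋈ W`, `[2I-J-J'; -J; -J'] = W ⋈ (2, -1, -1)ᵀ`).
[cite: KazeevKhoromskij2012, Lem. 2.1] -/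
def lapTrain (d : ℕ) : TensorTrain K (Fin 2 × Fin 2) d :=
  TensorTrain.uniform d 3 (fun _ => lapCore K) ![1, 0, 0] ![2, -1, -1]

/-- The rank-`4` train of `Δ_DN` (Lem. 2.2) in uniform form: boundaries `(1, 0, 0, 1)`,
`(2, -1, -1, -1)`.  [cite: KazeevKhoromskij2012, Lem. 2.2] -/
def lapDNTrain (d : ℕ) : TensorTrain K (Fin 2 × Fin 2) d :=
  TensorTrain.uniform d 4 (fun _ => lapDNCore K) ![1, 0, 0, 1] ![2, -1, -1, -1]

/-- The rank-`4` train of `Δ_ND` (Lem. 2.2) in uniform form: boundaries `(1, 0, 0, 1)`,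
`(2, -1, -1, -1)`.  [cite: KazeevKhoromskij2012, Lem. 2.2] -/
def lapNDTrain (d : ℕ) : TensorTrain K (Fin 2 × Fin 2) d :=
  TensorTrain.uniform d 4 (fun _ => lapNDCore K) ![1, 0, 0, 1] ![2, -1, -1, -1]

/-- The rank-`5` train of `Δ_P` (proof of Lem. 2.2) in uniform form: boundaries
`(1, 0, 0, 1, 1)`, `(2, -1, -1, -1, -1)`.  [cite: KazeevKhoromskij2012, Lem. 2.2] -/
def lapPTrain (d : ℕ) : TensorTrain K (Fin 2 × Fin 2) d :=
  TensorTrain.uniform d 5 (fun _ => lapPCore K) ![1, 0, 0, 1, 1] ![2, -1, -1, -1, -1]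

/-! ### State vectors of the digit automata -/

/-- States of the shift automaton after reading the leading digits `m`, `n`:
`(𝟙[m = n], 𝟙[n = m + 1])`.  [cite: KazeevKhoromskij2012, eq. (13)] -/
def shiftVec (m n : ℕ) : Fin 2 → K :=
  ![if m = n then 1 else 0, if n = m + 1 then 1 else 0]

/-- States of the periodic-shift automaton at level `k`:
`(𝟙[m = n], 𝟙[n = m + 1], 𝟙[m = 2^k - 1 ∧ n = 0])`.  [cite: KazeevKhoromskij2012, eq. (14)] -/
def shiftPVec (k m n : ℕ) : Fin 3 → K :=
  ![if m = n then 1 else 0, if n = m + 1 then 1 else 0, if m + 1 = 2 ^ k ∧ n = 0 then 1 else 0]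

/-- States of the Laplace automaton: `(𝟙[m = n], 𝟙[m = n + 1], 𝟙[n = m + 1])`.
[cite: KazeevKhoromskij2012, Lem. 2.1] -/
def lapVec (m n : ℕ) : Fin 3 → K :=
  ![if m = n then 1 else 0, if m = n + 1 then 1 else 0, if n = m + 1 then 1 else 0]

/-- States of the `Δ_DN` automaton at level `k`: the Laplace states and
`𝟙[m = n = 2^k - 1]`.  [cite: KazeevKhoromskij2012, Lem. 2.2] -/
def lapDNVec (k m n : ℕ) : Fin 4 → K :=
  ![if m = n then 1 else 0, if m = n + 1 then 1 else 0, if n = m + 1 then 1 else 0,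
    if m + 1 = 2 ^ k ∧ n + 1 = 2 ^ k then 1 else 0]

/-- States of the `Δ_ND` automaton: the Laplace states and `𝟙[m = n = 0]`.
[cite: KazeevKhoromskij2012, Lem. 2.2] -/
def lapNDVec (m n : ℕ) : Fin 4 → K :=
  ![if m = n then 1 else 0, if m = n + 1 then 1 else 0, if n = m + 1 then 1 else 0,
    if m = 0 ∧ n = 0 then 1 else 0]

/-- States of the `Δ_P` automaton at level `k`: the Laplace states,
`𝟙[m = 0 ∧ n = 2^k - 1]` and `𝟙[m = 2^k - 1 ∧ n = 0]`.  [cite: KazeevKhoromskij2012, Lem. 2.2] -/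
def lapPVec (k m n : ℕ) : Fin 5 → K :=
  ![if m = n then 1 else 0, if m = n + 1 then 1 else 0, if n = m + 1 then 1 else 0,
    if m = 0 ∧ n + 1 = 2 ^ k then 1 else 0, if m + 1 = 2 ^ k ∧ n = 0 then 1 else 0]

variable {K}

/-- [folklore] One step of the shift automaton (bookkeeping case analysis). -/
private theorem shiftVec_step (m n : ℕ) (a a' : Fin 2) :
    shiftVec K (2 * m + a) (2 * n + a') = shiftVec K m n ᵥ* shiftCore K (a, a') := by
  ext j
  fin_cases a <;> fin_cases a' <;> fin_cases j <;>
    simp [shiftVec, shiftCore, blkI, blkJ, blkJ', Matrix.vecMul, dotProduct, Fin.sum_univ_two] <;>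
    (try split_ifs) <;> first | rfl | omega

/-- [folklore] One step of the periodic-shift automaton (bookkeeping case analysis). -/
private theorem shiftPVec_step (k m n : ℕ) (a a' : Fin 2) :
    shiftPVec K (k + 1) (2 * m + a) (2 * n + a') = shiftPVec K k m n ᵥ* shiftPCore K (a, a') := by
  ext j
  rw [shiftPVec, pow_succ]
  fin_cases a <;> fin_cases a' <;> fin_cases j <;>
    simp [shiftPVec, shiftPCore, blkI, blkJ, blkJ', Matrix.vecMul, dotProduct,
      Fin.sum_univ_three] <;>
    (try split_ifs) <;> first | rfl | omega

/-- [folklore] One step of the Laplace automaton (bookkeeping case analysis). -/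
private theorem lapVec_step (m n : ℕ) (a a' : Fin 2) :
    lapVec K (2 * m + a) (2 * n + a') = lapVec K m n ᵥ* lapCore K (a, a') := by
  ext j
  fin_cases a <;> fin_cases a' <;> fin_cases j <;>
    simp [lapVec, lapCore, blkI, blkJ, blkJ', Matrix.vecMul, dotProduct, Fin.sum_univ_three] <;>
    (try split_ifs) <;> first | rfl | omega

/-- [folklore] One step of the `Δ_DN` automaton (bookkeeping case analysis). -/
private theorem lapDNVec_step (k m n : ℕ) (a a' : Fin 2) :
    lapDNVec K (k + 1) (2 * m + a) (2 * n + a') = lapDNVec K k m n ᵥ* lapDNCore K (a, a') := by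
  ext j
  rw [lapDNVec, pow_succ]
  fin_cases a <;> fin_cases a' <;> fin_cases j <;>
    simp [lapDNVec, lapDNCore, blkI, blkJ, blkJ', blkI₂, Matrix.vecMul, dotProduct,
      Fin.sum_univ_four] <;>
    (try split_ifs) <;> first | rfl | omega

/-- [folklore] One step of the `Δ_ND` automaton (bookkeeping case analysis). -/
private theorem lapNDVec_step (m n : ℕ) (a a' : Fin 2) :
    lapNDVec K (2 * m + a) (2 * n + a') = lapNDVec K m n ᵥ* lapNDCore K (a, a') := by
  ext j
  fin_cases a <;> fin_cases a' <;> fin_cases j <;>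
    simp [lapNDVec, lapNDCore, blkI, blkJ, blkJ', blkI₁, Matrix.vecMul, dotProduct,
      Fin.sum_univ_four] <;>
    (try split_ifs) <;> first | rfl | omega

/-- [folklore] One step of the `Δ_P` automaton (bookkeeping case analysis). -/
private theorem lapPVec_step (k m n : ℕ) (a a' : Fin 2) :
    lapPVec K (k + 1) (2 * m + a) (2 * n + a') = lapPVec K k m n ᵥ* lapPCore K (a, a') := by
  ext j
  rw [lapPVec, pow_succ]
  fin_cases a <;> fin_cases a' <;> fin_cases j <;>
    simp [lapPVec, lapPCore, blkI, blkJ, blkJ', Matrix.vecMul, dotProduct,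
      Fin.sum_univ_five] <;>
    (try split_ifs) <;> first | rfl | omega

/-! ### The shift and gradient matrices: QTT ranks two (eqs. (12), (13)) -/

/-- Reading the digit pairs most significant first, `(1, 0) · [I J; 0 J'](σ₀, μ₀) ⋯ =
(𝟙[m(σ) = m(μ)], 𝟙[m(μ) = m(σ) + 1])`.  [cite: KazeevKhoromskij2012, eq. (13)] -/
theorem vecMul_chainProd_shiftCore (d : ℕ) (σ μ : Fin d → Fin 2) :
    ![(1 : K), 0] ᵥ* TensorTrain.chainProd (fun _ => shiftCore K) d (fun r => (σ r, μ r)) =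
      shiftVec K (quanticsEquiv 2 d σ) (quanticsEquiv 2 d μ) := by
  have h0 : shiftVec K 0 0 = ![1, 0] := by
    ext j; fin_cases j <;> simp [shiftVec]
  rw [← h0]
  exact TensorTrain.vecMul_chainProd_of_digitStep (shiftCore K) (fun _ => shiftVec K)
    (fun _ m m' a a' _ _ => shiftVec_step m m' a a') d σ μ

/-- THE SHIFT/GRADIENT TRAIN REPRESENTS `c₀ I + c₁ S`: entry `c₀ 𝟙[m = n] + c₁ 𝟙[n = m + 1]`.
[cite: KazeevKhoromskij2012, eq. (13)] -/
theorem eval_shiftTrain (c : Fin 2 → K) (d : ℕ) (σ μ : Fin d → Fin 2) :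
    (shiftTrain K c d).eval (fun r => (σ r, μ r)) =
      c 0 * (if (quanticsEquiv 2 d σ : ℕ) = quanticsEquiv 2 d μ then 1 else 0) +
        c 1 * (if (quanticsEquiv 2 d μ : ℕ) = quanticsEquiv 2 d σ + 1 then 1 else 0) := by
  rw [shiftTrain, TensorTrain.eval_uniform, vecMul_chainProd_shiftCore]
  simp [shiftVec, dotProduct, Fin.sum_univ_two, mul_comm]

/-- THE SHIFT MATRIX HAS QTT RANKS TWO: `S^{(d)} = [I J] ⋈ [I J; 0 J']^{⋈(d-2)} ⋈ [J; J']`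
(eq. (13); here in the uniform form with boundary vectors `(1, 0)`, `(0, 1)`, valid for every
`d ≥ 0`).  [cite: KazeevKhoromskij2012, eq. (13)] -/
theorem qttMatrix_shiftTrain_shift (d : ℕ) :
    (shiftTrain K ![0, 1] d).qttMatrix = shiftS K (2 ^ d) := by
  rw [TensorTrain.qttMatrix_eq_iff]
  intro σ μ
  rw [eval_shiftTrain]
  simp [shiftS]

/-- THE GRADIENT MATRIX HAS QTT RANKS TWO: `G^{(d)} = [I J] ⋈ [I J; 0 J']^{⋈(d-2)} ⋈ [I-J; -J']`
(eq. (12); uniform form with boundary vectors `(1, 0)`, `(1, -1)`).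
[cite: KazeevKhoromskij2012, eq. (12)] -/
theorem qttMatrix_shiftTrain_grad (d : ℕ) :
    (shiftTrain K ![1, -1] d).qttMatrix = gradG K (2 ^ d) := by
  rw [TensorTrain.qttMatrix_eq_iff]
  intro σ μ
  rw [eval_shiftTrain, gradG, Matrix.of_apply]
  simp only [Matrix.cons_val_zero, Matrix.cons_val_one]
  split_ifs <;> first | omega | simp

/-! ### The periodic shift: QTT ranks three (eq. (14)) -/

/-- The periodic-shift automaton: `(1, 0, 1) · [I J 0; 0 J' 0; 0 0 J'](σ₀, μ₀) ⋯ =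
(𝟙[m = n], 𝟙[n = m + 1], 𝟙[m = 2^d - 1 ∧ n = 0])`.  [cite: KazeevKhoromskij2012, eq. (14)] -/
theorem vecMul_chainProd_shiftPCore (d : ℕ) (σ μ : Fin d → Fin 2) :
    ![(1 : K), 0, 1] ᵥ* TensorTrain.chainProd (fun _ => shiftPCore K) d (fun r => (σ r, μ r)) =
      shiftPVec K d (quanticsEquiv 2 d σ) (quanticsEquiv 2 d μ) := by
  have h0 : shiftPVec K 0 0 0 = ![1, 0, 1] := by
    ext j; fin_cases j <;> simp [shiftPVec]
  rw [← h0]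
  exact TensorTrain.vecMul_chainProd_of_digitStep (shiftPCore K) (shiftPVec K)
    (fun k m m' a a' _ _ => shiftPVec_step k m m' a a') d σ μ

/-- [folklore] Output of the periodic-shift automaton (bookkeeping case analysis). -/
private theorem shiftPVec_dotProduct (k m n : ℕ) :
    shiftPVec K k m n ⬝ᵥ ![0, 1, 1] =
      if n = m + 1 ∨ (m + 1 = 2 ^ k ∧ n = 0) then 1 else 0 := by
  simp [shiftPVec, dotProduct, Fin.sum_univ_three]
  split_ifs <;> first | omega | simp

/-- THE PERIODIC SHIFT HAS QTT RANKS THREE: `S_P^{(d)} = S^{(d)} + J'^{⊗d} =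
[I J J'] ⋈ diag([I J; 0 J'], J')^{⋈(d-2)} ⋈ [J; J'; J']` (eq. (14); uniform form with boundary
vectors `(1, 0, 1)`, `(0, 1, 1)`): the represented matrix is the cyclic shift
`𝟙[n ≡ m + 1 (mod 2^d)]`.  [cite: KazeevKhoromskij2012, eq. (14)] -/
theorem qttMatrix_shiftPTrain (d : ℕ) :
    (shiftPTrain K d).qttMatrix = Matrix.of fun m n : Fin (2 ^ d) =>
      if (n : ℕ) = m + 1 ∨ ((m : ℕ) + 1 = 2 ^ d ∧ (n : ℕ) = 0) then (1 : K) else 0 := by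
  rw [TensorTrain.qttMatrix_eq_iff]
  intro σ μ
  rw [shiftPTrain, TensorTrain.eval_uniform, vecMul_chainProd_shiftPCore, Matrix.of_apply]
  exact shiftPVec_dotProduct d _ _

/-! ### Lemma 2.1: the Dirichlet Laplacian has QTT ranks three -/

/-- The Laplace automaton: `e₀ᵀ · W(σ₀, μ₀) ⋯ W(σ_{d-1}, μ_{d-1}) =
(𝟙[m = n], 𝟙[m = n + 1], 𝟙[n = m + 1])` for `m = m(σ)`, `n = m(μ)`.
[cite: KazeevKhoromskij2012, Lem. 2.1] -/
theorem vecMul_chainProd_lapCore (d : ℕ) (σ μ : Fin d → Fin 2) :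
    ![(1 : K), 0, 0] ᵥ* TensorTrain.chainProd (fun _ => lapCore K) d (fun r => (σ r, μ r)) =
      lapVec K (quanticsEquiv 2 d σ) (quanticsEquiv 2 d μ) := by
  have h0 : lapVec K 0 0 = ![1, 0, 0] := by
    ext j; fin_cases j <;> simp [lapVec]
  rw [← h0]
  exact TensorTrain.vecMul_chainProd_of_digitStep (lapCore K) (fun _ => lapVec K)
    (fun _ m m' a a' _ _ => lapVec_step m m' a a') d σ μ

/-- [folklore] Output of the Laplace automaton (bookkeeping case analysis). -/
private theorem lapVec_dotProduct (m n : ℕ) :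
    lapVec K m n ⬝ᵥ ![2, -1, -1] =
      if m = n then 2 else if n = m + 1 ∨ m = n + 1 then -1 else 0 := by
  simp [lapVec, dotProduct, Fin.sum_univ_three]
  split_ifs <;> first | omega | simp

/-- The value of the Laplace train at a string of digit pairs is the Laplacian entry
`2·𝟙[m = n] - 𝟙[m = n + 1] - 𝟙[n = m + 1]`.  [cite: KazeevKhoromskij2012, Lem. 2.1] -/
theorem eval_lapTrain (d : ℕ) (σ μ : Fin d → Fin 2) :
    (lapTrain K d).eval (fun r => (σ r, μ r)) =
      laplaceDD K (2 ^ d) (quanticsEquiv 2 d σ) (quanticsEquiv 2 d μ) := by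
  rw [lapTrain, TensorTrain.eval_uniform, vecMul_chainProd_lapCore, laplaceDD, Matrix.of_apply]
  exact lapVec_dotProduct _ _

/-- LEMMA 2.1 (KAZEEV–KHOROMSKIJ): THE DIRICHLET LAPLACIAN `Δ_DD^{(d)} = tridiag(-1, 2, -1)` OF
SIZE `2^d` HAS THE EXPLICIT RANK-`3` QTT REPRESENTATION
`Δ_DD^{(d)} = [I J' J] ⋈ [I J' J; 0 J 0; 0 0 J']^{⋈(d-2)} ⋈ [2I - J - J'; -J; -J']`
— here in the uniform form (cores `W`, boundary vectors `(1, 0, 0)` and `(2, -1, -1)`), valid for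
every `d ≥ 0` [KazeevKhoromskij2012, Lem. 2.1; Khoromskij2015, §1.4].
[cite: KazeevKhoromskij2012, Lem. 2.1] -/
theorem qttMatrix_lapTrain (d : ℕ) : (lapTrain K d).qttMatrix = laplaceDD K (2 ^ d) := by
  rw [TensorTrain.qttMatrix_eq_iff]
  exact eval_lapTrain d

/-- [folklore] The entry of `row · M · column` is the bilinear pairing (bookkeeping). -/
private theorem row_mul_mul_col_apply {n : ℕ} (u v : Fin n → K) (M : Matrix (Fin n) (Fin n) K) :
    (Matrix.of (fun (_ : Fin 1) j => u j) * M * Matrix.of (fun i (_ : Fin 1) => v i)) 0 0 =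
      u ᵥ* M ⬝ᵥ v := by
  simp only [Matrix.mul_apply, Matrix.vecMul, dotProduct, Matrix.of_apply]

/-- [folklore] The first core of Lem. 2.1 is `e₀ᵀ ⋈ W` (bookkeeping). -/
private theorem lapFirst_eq (p : Fin 2 × Fin 2) :
    lapFirst K p = Matrix.of fun (_ : Fin 1) j => (![(1 : K), 0, 0] ᵥ* lapCore K p) j := by
  ext i j
  fin_cases i; fin_cases j <;>
    simp [lapFirst, lapCore, Matrix.vecMul, dotProduct, Fin.sum_univ_three]

/-- [folklore] The last core of Lem. 2.1 is `W ⋈ (2, -1, -1)ᵀ` (bookkeeping). -/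
private theorem lapLast_eq (p : Fin 2 × Fin 2) :
    lapLast K p = Matrix.of fun i (_ : Fin 1) => (lapCore K p *ᵥ ![(2 : K), -1, -1]) i := by
  ext i j
  fin_cases j; fin_cases i <;>
    simp [lapLast, lapCore, Matrix.mulVec, dotProduct, Fin.sum_univ_three]
  ring

/-- LEMMA 2.1 VERBATIM (`d = k + 2 ≥ 2`): with the row/column digit pairs `(i₁, j₁), …, (i_d, j_d)`
of `(m, n)`, the unique entry of the `1 × 1` matrix
`[I J' J](i₁,j₁) · W(i₂,j₂) ⋯ W(i_{d-1},j_{d-1}) · [2I-J-J'; -J; -J'](i_d,j_d)` — the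
`((i₁…i_d), (j₁…j_d))` block entry of the strong Kronecker product
`[I J' J] ⋈ W^{⋈(d-2)} ⋈ [2I-J-J'; -J; -J']` (Rem. 0.6) — is `Δ_DD^{(d)}(m, n)`.
[cite: KazeevKhoromskij2012, Lem. 2.1] -/
theorem laplaceDD_eq_lapFirst_mul_chainProd_mul_lapLast (k : ℕ) (σ μ : Fin (k + 2) → Fin 2) :
    (lapFirst K (σ 0, μ 0) *
        TensorTrain.chainProd (fun _ => lapCore K) k
          (fun r : Fin k => (σ r.succ.castSucc, μ r.succ.castSucc)) *
        lapLast K (σ (Fin.last (k + 1)), μ (Fin.last (k + 1)))) 0 0 =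
      laplaceDD K (2 ^ (k + 2)) (quanticsEquiv 2 (k + 2) σ) (quanticsEquiv 2 (k + 2) μ) := by
  rw [← eval_lapTrain, lapTrain, TensorTrain.eval_uniform, TensorTrain.chainProd,
    TensorTrain.chainProd_succ_eq_mul, lapFirst_eq, lapLast_eq, row_mul_mul_col_apply]
  simp only [← Matrix.vecMul_vecMul, Matrix.dotProduct_mulVec]
  rfl

/-! ### Lemma 2.2: other boundary conditions -/

/-- The `Δ_DN` automaton.  [cite: KazeevKhoromskij2012, Lem. 2.2] -/
theorem vecMul_chainProd_lapDNCore (d : ℕ) (σ μ : Fin d → Fin 2) :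
    ![(1 : K), 0, 0, 1] ᵥ* TensorTrain.chainProd (fun _ => lapDNCore K) d (fun r => (σ r, μ r)) =
      lapDNVec K d (quanticsEquiv 2 d σ) (quanticsEquiv 2 d μ) := by
  have h0 : lapDNVec K 0 0 0 = ![1, 0, 0, 1] := by
    ext j; fin_cases j <;> simp [lapDNVec]
  rw [← h0]
  exact TensorTrain.vecMul_chainProd_of_digitStep (lapDNCore K) (lapDNVec K)
    (fun k m m' a a' _ _ => lapDNVec_step k m m' a a') d σ μ

/-- [folklore] Output of the `Δ_DN` automaton (bookkeeping case analysis). -/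
private theorem lapDNVec_dotProduct (k m n : ℕ) :
    lapDNVec K k m n ⬝ᵥ ![2, -1, -1, -1] =
      if m = n then (if m + 1 = 2 ^ k then 1 else 2)
      else if n = m + 1 ∨ m = n + 1 then -1 else 0 := by
  simp [lapDNVec, dotProduct, Fin.sum_univ_four]
  split_ifs <;> first | omega | norm_num

/-- LEMMA 2.2, `Δ_DN`: `Δ_DN^{(d)} = Δ_DD^{(d)} - I₂^{⊗d} =
[I J' J I₂] ⋈ diag(W, I₂)^{⋈(d-2)} ⋈ [2I-J-J'; -J; -J'; -I₂]` has QTT ranks `4` (uniform form,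
boundary vectors `(1, 0, 0, 1)`, `(2, -1, -1, -1)`, every `d ≥ 0`).
[cite: KazeevKhoromskij2012, Lem. 2.2] -/
theorem qttMatrix_lapDNTrain (d : ℕ) : (lapDNTrain K d).qttMatrix = laplaceDN K (2 ^ d) := by
  rw [TensorTrain.qttMatrix_eq_iff]
  intro σ μ
  rw [lapDNTrain, TensorTrain.eval_uniform, vecMul_chainProd_lapDNCore, laplaceDN, Matrix.of_apply]
  exact lapDNVec_dotProduct d _ _

/-- The `Δ_ND` automaton.  [cite: KazeevKhoromskij2012, Lem. 2.2] -/
theorem vecMul_chainProd_lapNDCore (d : ℕ) (σ μ : Fin d → Fin 2) :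
    ![(1 : K), 0, 0, 1] ᵥ* TensorTrain.chainProd (fun _ => lapNDCore K) d (fun r => (σ r, μ r)) =
      lapNDVec K (quanticsEquiv 2 d σ) (quanticsEquiv 2 d μ) := by
  have h0 : lapNDVec K 0 0 = ![1, 0, 0, 1] := by
    ext j; fin_cases j <;> simp [lapNDVec]
  rw [← h0]
  exact TensorTrain.vecMul_chainProd_of_digitStep (lapNDCore K) (fun _ => lapNDVec K)
    (fun _ m m' a a' _ _ => lapNDVec_step m m' a a') d σ μ

/-- [folklore] Output of the `Δ_ND` automaton (bookkeeping case analysis). -/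
private theorem lapNDVec_dotProduct (m n : ℕ) :
    lapNDVec K m n ⬝ᵥ ![2, -1, -1, -1] =
      if m = n then (if m = 0 then 1 else 2)
      else if n = m + 1 ∨ m = n + 1 then -1 else 0 := by
  simp [lapNDVec, dotProduct, Fin.sum_univ_four]
  split_ifs <;> first | omega | norm_num

/-- LEMMA 2.2, `Δ_ND`: `Δ_ND^{(d)} = Δ_DD^{(d)} - I₁^{⊗d} =
[I J' J I₁] ⋈ diag(W, I₁)^{⋈(d-2)} ⋈ [2I-J-J'; -J; -J'; -I₁]` has QTT ranks `4` (uniform form,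
boundary vectors `(1, 0, 0, 1)`, `(2, -1, -1, -1)`, every `d ≥ 0`).
[cite: KazeevKhoromskij2012, Lem. 2.2] -/
theorem qttMatrix_lapNDTrain (d : ℕ) : (lapNDTrain K d).qttMatrix = laplaceND K (2 ^ d) := by
  rw [TensorTrain.qttMatrix_eq_iff]
  intro σ μ
  rw [lapNDTrain, TensorTrain.eval_uniform, vecMul_chainProd_lapNDCore, laplaceND, Matrix.of_apply]
  exact lapNDVec_dotProduct _ _

/-- The `Δ_P` automaton.  [cite: KazeevKhoromskij2012, Lem. 2.2] -/
theorem vecMul_chainProd_lapPCore (d : ℕ) (σ μ : Fin d → Fin 2) :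
    ![(1 : K), 0, 0, 1, 1] ᵥ* TensorTrain.chainProd (fun _ => lapPCore K) d (fun r => (σ r, μ r)) =
      lapPVec K d (quanticsEquiv 2 d σ) (quanticsEquiv 2 d μ) := by
  have h0 : lapPVec K 0 0 0 = ![1, 0, 0, 1, 1] := by
    ext j; fin_cases j <;> simp [lapPVec]
  rw [← h0]
  exact TensorTrain.vecMul_chainProd_of_digitStep (lapPCore K) (lapPVec K)
    (fun k m m' a a' _ _ => lapPVec_step k m m' a a') d σ μ

/-- [folklore] Output of the `Δ_P` automaton (bookkeeping case analysis). -/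
private theorem lapPVec_dotProduct (k m n : ℕ) :
    lapPVec K k m n ⬝ᵥ ![2, -1, -1, -1, -1] =
      (if m = n then 2 else 0)
        - (if n = m + 1 ∨ (m + 1 = 2 ^ k ∧ n = 0) then 1 else 0)
        - (if m = n + 1 ∨ (n + 1 = 2 ^ k ∧ m = 0) then 1 else 0) := by
  simp [lapPVec, dotProduct, Fin.sum_univ_five]
  split_ifs <;> first | omega | norm_num

/-- LEMMA 2.2 (proof), `Δ_P`: `Δ_P^{(d)} = Δ_DD^{(d)} - J^{⊗d} - J'^{⊗d} =
[I J' J J J'] ⋈ diag(W, J, J')^{⋈(d-2)} ⋈ [2I-J-J'; -J; -J'; -J; -J']` — a rank-`5` QTT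
representation of the periodic Laplacian (uniform form, boundary vectors `(1, 0, 0, 1, 1)`,
`(2, -1, -1, -1, -1)`, every `d ≥ 0`; the lemma itself reduces the ranks to `2, 3, …, 3`, not
formalised).  [cite: KazeevKhoromskij2012, Lem. 2.2] -/
theorem qttMatrix_lapPTrain (d : ℕ) : (lapPTrain K d).qttMatrix = laplaceP K (2 ^ d) := by
  rw [TensorTrain.qttMatrix_eq_iff]
  intro σ μ
  rw [lapPTrain, TensorTrain.eval_uniform, vecMul_chainProd_lapPCore, laplaceP, Matrix.of_apply]
  exact lapPVec_dotProduct d _ _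

end KazeevKhoromskij

end Literature.LinearAlgebra.TensorNetworks
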